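import Literature.NumberTheory.Rogawski1990.UnitOrbitalIntegralInertCountJZeroTorusAll
import Literature.NumberTheory.Rogawski1990.UnitOrbitalIntegralInertValueThetaOneClosed
import Literature.NumberTheory.Automorphic.UnitOrbitalIntegralUnfoldingHK
import HarnessLib

/-!
# LAYER C, `θ̄ = 0`, CLOSED at the `U`-level: `#{q ∈ U⧸K : t(a,b,c)·q = q} = φ₀(N₁, N₂, N)` (modulo the case-(e) count)
(Flicker (1998), *Elementary proof of the fundamental lemma for a unitary group*, Prop. 5 p. 82, Cor. 9 p. 85, Prop. 10, Prop. 13, Prop. 14 p. 94)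

Topic `NumberTheory/Rogawski1990` (road «D-N7-inert», MAP v3 LAYER C, value `X₁`; layer T2 of census `F0/P3/F0P3b-p01/g6/CENSUS-LayerC-X1-ThetaZero.F0P3bp01g6.md`);
namespace `Literature.NumberTheory.Automorphic.UnitaryGroup`.  THEOREMS ONLY; kernel lane.  Pen F0P3b-p01 (g6); the `θ̄ = 0` twin of ★ A-p03
`natCard_fixedPoints_unitaryInt_flickerTorus_eq_phiOne_of_bridge`.  HONEST LABEL: HC_CM is proved only modulo the 2 remaining named inputs (hLiu418, h413) until
rung 0 closes; the one named gap of this value is the case-(e) residue count `hce` (threaded verbatim).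

`natCard_fixedPoints_unitaryInt_flickerTorusOne_eq_phiZero_of_bridge`: ★ Prop. 5 `natCard_fixedPoints_unitaryInt_eq_finsum_flickerU` (the sum over the levels `m`,
finite support by ★ `finite_setOf_nonempty_fixedPoints_flickerU`) + ★ A-p03 `subgroupOf_flickerHK_eq` (the two spellings of `H^K_m ∩ Z(c)`) + ★ T1b
`finsum_natCard_fixedPoints_flickerTorusOne_eq_phiZero`.

## References
* [Flicker1998UnitaryFL] Y. Z. Flicker, *Elementary proof of the fundamental lemma for a unitary group*, Canad. J. Math. 50 (1998), 74–98.
* [Rogawski1990] J. D. Rogawski, *Automorphic Representations of Unitary Groups in Three Variables* (1990), §4.9 p. 55.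
-/

set_option autoImplicit false

open scoped MatrixGroups WithZero Valued
open Matrix

namespace Literature.NumberTheory.Automorphic

namespace UnitaryGroup

open Literature.NumberTheory.Automorphic.HermitianLattice (unitaryInt mem_unitaryInt_iff LocalConjDatum)
open Literature.NumberTheory.Rogawski1990.Flicker1998 (phiZero)
open IsLocalRing

universe u

variable {K : Type*} [Field K] [Valued K ℤᵐ⁰] {ϖ : K} (σ : K →+* K) {J : Matrix (Fin 3) (Fin 3) K}

section ThetaZeroClosed

variable [IsDiscreteValuationRing 𝒪[K]] [Finite (ResidueField 𝒪[K])] [IsAdicComplete (maximalIdeal 𝒪[K]) 𝒪[K]]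

set_option synthInstance.maxHeartbeats 200000 in
-- the `H`-action on `H ⧸ (K^{u_m} ∩ H)` is found through the large subgroup terms of the `U(2,1)` frame (as in ★ (F2))
/-- **LAYER C, `θ̄ = 0`, CLOSED (modulo the case-(e) count)**: for `t = t(a,b,c) = !![e(a+c),0,−e(a−c); 0,b,0; −e(a−c),0,e(a+c)]`,
`#{q ∈ U⧸K : t q = q} = phiZero q N₁ N₂ N` — Flicker's `θ̄ = 0` table summed (Prop. 5 + Cor. 9 + Prop. 10∕13 + Prop. 14), the orders `N, N₊, N₁, N₂` and the type datum as in
★ `sumThetaZero_eq_phiZero`. [cite: Flicker1998UnitaryFL, Prop. 5 p. 82; Cor. 9 p. 85; Prop. 13 pp. 91–93; Prop. 14 p. 94] -/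
theorem natCard_fixedPoints_unitaryInt_flickerTorusOne_eq_phiZero_of_bridge (hJ : J = (StdForm.antidiagonal 3).over K) (hd : LocalConjDatum σ ϖ)
    (hσO : ∀ y : 𝒪[K], (σ.comp 𝒪[K].subtype) y ∈ 𝒪[K]) {y : K} (hy : y * σ y = -2)
    {c : ↥(unitaryGroupOfForm σ J)} (hc : ((c : GL (Fin 3) K) : Matrix (Fin 3) (Fin 3) K) = !![1, 0, 0; 0, -1, 0; 0, 0, 1])
    (u : ℕ → ↥(unitaryGroupOfForm σ J))
    (hum : ∀ m, ((u m : GL (Fin 3) K) : Matrix (Fin 3) (Fin 3) K) = !![ϖ ^ m, y, (ϖ ^ m)⁻¹; 0, 1, -σ y * (ϖ ^ m)⁻¹; 0, 0, (ϖ ^ m)⁻¹])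
    {R : Type u} [CommRing R] [IsDomain R] [IsDiscreteValuationRing R] [Finite (ResidueField R)] (ι : R →+* K) (hι : Function.Injective ι)
    (hιv : ∀ x : K, Valued.v x ≤ 1 ↔ x ∈ Set.range ι) (σR : R →+* R) (hσR : ∀ r, σR (σR r) = r) (hσι : ∀ r, ι (σR r) = σ (ι r))
    {dR : R} (hdRσ : σR dR = -dR) (hdRu : IsUnit dR) (h2R : IsUnit (2 : R)) {ϖR : R} (hϖR : Irreducible ϖR) (hιϖ : ι ϖR = ϖ)
    {q : ℕ} (hqR : Nat.card (ResidueField R) = q ^ 2) (hq : Nat.card (ResidueField 𝒪[K]) = q ^ 2)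
    {a₀ : 𝒪[K]} (ha₀ : IsUnit (((σ.comp 𝒪[K].subtype).codRestrict 𝒪[K] hσO) a₀ - a₀))
    {e a b cc : K} (h2e : 2 * e = 1) (ha : σ a * a = 1) (hb : σ b * b = 1) (hcc : σ cc * cc = 1)
    {t : ↥(unitaryGroupOfForm σ J)}
    (hte : ((t : GL (Fin 3) K) : Matrix (Fin 3) (Fin 3) K) = !![e * (a + cc), 0, -(e * (a - cc)); 0, b, 0; -(e * (a - cc)), 0, e * (a + cc)])
    (htH : t ∈ Subgroup.centralizer ({c} : Set ↥(unitaryGroupOfForm σ J)))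
    (r : ℕ → ↥(Subgroup.centralizer ({c} : Set ↥(unitaryGroupOfForm σ J))))
    (hr : ∀ i, (((r i : ↥(unitaryGroupOfForm σ J)) : GL (Fin 3) K) : Matrix (Fin 3) (Fin 3) K) = !![(ϖ ^ i)⁻¹, 0, 0; 0, 1, 0; 0, 0, ϖ ^ i])
    {N Np N₁ N₂ : ℕ} (hN : Valued.v (a - cc) = Valued.v (ϖ ^ N)) (hNp : Valued.v (a + cc - 2 * b) = Valued.v (ϖ ^ Np))
    (hN₁ : Valued.v (a - b) = Valued.v (ϖ ^ N₁)) (hN₂ : Valued.v (cc - b) = Valued.v (ϖ ^ N₂))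
    (h : (N₁ < N ∧ N₂ = N₁ ∧ Np = N₁) ∨ (N ≤ N₁ ∧ N ≤ Np))
    (hce : ∀ m, N < m → N ≤ Np → max N₁ N₂ < 2 * m → 2 * m ≤ max N₁ N₂ + N → (max N₁ N₂ - N) % 2 = 0 →
      (∀ p ∈ flickerPH σ J c, ∀ u' x w : K,
        ((p : GL (Fin 3) K) : Matrix (Fin 3) (Fin 3) K) = !![u', 0, u' * x; 0, w, 0; 0, 0, (σ u')⁻¹] →
          (p⁻¹ * t * p ∈ flickerHK σ J c (u m) ↔
            Valued.v (((u' * σ u')⁻¹ + -(e * ((a + cc - 2 * b) / (a - cc) + σ ((a + cc - 2 * b) / (a - cc)))) + x) *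
                σ ((u' * σ u')⁻¹ + -(e * ((a + cc - 2 * b) / (a - cc) + σ ((a + cc - 2 * b) / (a - cc)))) + x) -
              ((-(e * ((a + cc - 2 * b) / (a - cc) + σ ((a + cc - 2 * b) / (a - cc))))) ^ 2 - 1)) ≤ Valued.v (ϖ ^ (2 * m - N)))) →
      Nat.card {w : ↥(flickerPH σ J c) ⧸ (flickerHK σ J c (u m)).subgroupOf (flickerPH σ J c) //
        ((Quotient.out w : ↥(flickerPH σ J c)) : ↥(unitaryGroupOfForm σ J))⁻¹ * t * (Quotient.out w : ↥(flickerPH σ J c)) ∈ flickerHK σ J c (u m)} =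
        (q + 1) ^ 2 * q ^ (2 * m + N - 2))
    (hfin : {x : ↥(unitaryGroupOfForm σ J) ⧸ unitaryInt σ J | t • x = x}.Finite) :
    (Nat.card {x : ↥(unitaryGroupOfForm σ J) ⧸ unitaryInt σ J | t • x = x} : ℚ) = phiZero q N₁ N₂ N := by
  have hS : ∀ m, (flickerHK σ J c (u m)).subgroupOf (Subgroup.centralizer ({c} : Set ↥(unitaryGroupOfForm σ J))) =
      ((unitaryInt σ J).map (MulAut.conj (u m)).toMonoidHom).subgroupOf (Subgroup.centralizer ({c} : Set ↥(unitaryGroupOfForm σ J))) := fun m => subgroupOf_flickerHK_eq σ c (u m)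
  have hlev := finite_setOf_nonempty_fixedPoints_flickerU σ hJ hd hy hc u hum htH hfin
  have hfinm : ∀ m, {x : ↥(Subgroup.centralizer ({c} : Set ↥(unitaryGroupOfForm σ J))) ⧸ (flickerHK σ J c (u m)).subgroupOf (Subgroup.centralizer ({c} : Set ↥(unitaryGroupOfForm σ J))) | (⟨t, htH⟩ : ↥(Subgroup.centralizer ({c} : Set ↥(unitaryGroupOfForm σ J)))) • x = x}.Finite := fun m => by
    rw [hS m]; exact Set.finite_coe_iff.1 (hlev.2 m)
  rw [natCard_fixedPoints_unitaryInt_eq_finsum_flickerU σ hJ hd hy hc u hum htH hfin]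
  have hsupp : (Function.support fun m => Nat.card {z : ↥(Subgroup.centralizer ({c} : Set ↥(unitaryGroupOfForm σ J))) ⧸
      ((unitaryInt σ J).map (MulAut.conj (u m)).toMonoidHom).subgroupOf (Subgroup.centralizer ({c} : Set ↥(unitaryGroupOfForm σ J))) | (⟨t, htH⟩ : ↥(Subgroup.centralizer ({c} : Set ↥(unitaryGroupOfForm σ J)))) • z = z}).Finite := by
    refine hlev.1.subset fun m hm => ?_
    rw [Function.mem_support] at hm
    exact (Nat.card_ne_zero.1 hm).1
  have hcast := (Nat.castAddMonoidHom ℚ).map_finsum hsupp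
  simp only [Nat.coe_castAddMonoidHom] at hcast
  rw [hcast, ← finsum_natCard_fixedPoints_flickerTorusOne_eq_phiZero σ hJ hd hσO hy hc u hum ι hι hιv σR hσR hσι hdRσ hdRu h2R hϖR hιϖ hqR hq ha₀
    h2e ha hb hcc hte htH r hr hN hNp hN₁ hN₂ h hce hfinm]
  refine finsum_congr fun m => ?_
  rw [hS m]
  rfl

end ThetaZeroClosed

end UnitaryGroup

end Literature.NumberTheory.Automorphic
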